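import Literature.MathematicalPhysics.QuantumLattice.TIDensityPhaseCoexistenceGrandCanonical
import Literature.MathematicalPhysics.QuantumLattice.HubbardTTPrimePhaseCoexistenceExclusionZeeman
import HarnessLib

/-!
# The competing-orders word of the 2D `t–t'` Hubbard model ON THE CHEMICAL-POTENTIAL AXIS: no jump of the grand-canonical
# density across `[n₁, n₂]` at any `μ`, and a CERTIFIED CHEMICAL-POTENTIAL GAP `Δμ ≥ M/(ab(n₂−n₁))` between the two excluded
# phases — at `T = 0`, at `T > 0` (hot anchors), and in a Zeeman field `h`

Topic `Literature/MathematicalPhysics/QuantumLattice` (family `hubbard`; cell `pub/hubbard-downfold`, MO-S1 ↔ S2 seam «box ↦ one word», filling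
direction = Legendre pair `μ ↔ n`; written 2026-08-28 by hubbard-downfold-unc-2 g22). The `t–t'` reading of
`TIDensityPhaseCoexistenceGrandCanonical` through the tree's identifications `e_ρ(Φ(t,t',U)) = energyDensityTT' t t' U ρ`
(`tiGroundEnergyDensityAt_hubbardTTPrime_eq_energyDensityTT'`), `P(β,Φ;ρ) = pressureTT' β t t' U ρ` (`varPressureAt_hubbardTTPrime_eq`) and, in a
Zeeman field `h` coupled to `N↑ − N↓`, the zero-field WINDOWS of `HubbardTTPrimeGroundEnergyZeeman` / `HubbardTTPrimeThermalPressureZeeman{,States}`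
for `Ψ_h = gcInteractionTT' t t' U 0 h`. Grand-canonical states: at `T = 0` the translation-invariant mean-energy minimisers
(`IsMeanEnergyMinimiser Γ 1`) and at `T > 0` the variational equilibria (`IsVarEquilibrium β Γ 1`) of ANY interaction `Γ` whose mean energy is
`e_Φ − μρ` (§0: `hubbardTTPrimeMuInteraction t t' U μ`, `gcInteractionTT' t t' U μ 0`) — resp. `e_{Ψ_h} − μρ` (`gcInteractionTT' t t' U μ h`).
PROVED (`U ≥ 0`, `0 < n₁ ≤ n₂ < 2`, weights `a, b ≥ 0`, `a + b = 1`, `Δ := n₂ − n₁`):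

* §1 `T = 0`, zero field (`margin_le_mul_sub_chemPot_of_groundStates_ttPrime`): a CAP `e(an₁ + bn₂) ≤ c` and FLOORS `f_i ≤ e(n_i)` give
  `a·b·Δ·(μ₂ − μ₁) ≥ af₁ + bf₂ − c =: M` whenever `μ₁` carries a grand-canonical ground state of density `≤ n₁` and `μ₂` one of density `≥ n₂`;
  one-sided forms `μ₁·bΔ ≤ c − f₁`, `f₂ − c ≤ μ₂·aΔ` (no second state needed: every density in `(0,2)` is realised); and with `M > 0`
  **`IsMeanEnergyMinimiser.not_isMeanEnergyMinimiser_of_le_of_le_ttPrime`**: at ONE `μ` the grand-canonical ground states of `H − μN` never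
  contain both a state of density `≤ n₁` and one of density `≥ n₂` — the density `n(μ)` of the model does not jump across `[n₁, n₂]`.
* §2 `T > 0`, zero field, HOT-ANCHORED (`…_of_equilibria_hotAnchors_ttPrime`): with the hypotheses of
  `HubbardTTPrimeThermalPhaseCoexistenceHotAnchor` (cap `c`, floors `f_i`, pressure ceilings `p(β_{h,i}; n_i) ≤ π_i` at hotter `β_{h,i} ≤ β`,
  `N := aπ₁ + bπ₂ + β_{h,1}af₁ + β_{h,2}bf₂`): `a·b·Δ·β(μ₂ − μ₁) ≥ βM − N` for equilibria at `(β, μ₁)` of density `≤ n₁` and at `(β, μ₂)` of density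
  `≥ n₂`; no equilibrium pair `(≤ n₁, ≥ n₂)` at one `(β, μ)` as soon as `N < βM`, threshold form «every `β ≥ β₀`».
* §3 IN A ZEEMAN FIELD `h` (`gcInteractionTT' t t' U μ h`): the same with `M ↦ M − |h|·m̄`, `m̄ = a·min(n₁,2−n₁) + b·min(n₂,2−n₂)`
  (`T = 0`: `…_of_groundStates_field_ttPrime`; `T > 0`: `…_of_equilibria_hotAnchors_field_ttPrime`; thresholds «`∀ β ≥ β₀, ∀ |h| ≤ h₀`»).

READING: «at `U/t = 8`, `t' = 0` every `μ` carrying a `≥ 1`-filled grand-canonical ground state lies at least `8M ≈ 0.40 t` above every `μ` carrying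
a `≤ ½`-filled one; at no `μ` does `n(μ)` jump from `≤ ½` to `≥ 1`» — the competing-orders CONTROL word on the axis of the chemical-potential-shift
experiments and of the grand-canonical Markov certificates. HONEST SCOPE: a FLOOR on `Δμ`, not an estimate; statements about translation-invariant
minimisers / variational equilibria; MACROSCOPIC coexistence only; Zeeman coupling only; inputs are the claim nodes / kernel rows of the instance
files; nothing about stripes, superconductivity or `T_c`. Everything is PROVED; no definition, no named fact, no number.

## Mathlib / tree search
REUSED: `margin_le_mul_sub_chemPot_of_isMeanEnergyMinimiser`, `IsMeanEnergyMinimiser.mul_sub_le_sub_of_density_le`, `…sub_le_mul_sub_of_le_density`,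
`pressureMargin_le_mul_sub_chemPot_of_isVarEquilibrium` (`TIDensityPhaseCoexistenceGrandCanonical`); `tiGroundEnergyDensityAt_hubbardTTPrime_eq_energyDensityTT'`,
`exists_isTranslationInvariant_density_eq`, `varPressureAt_hubbardTTPrime_eq`; `pressureTT'_mem_Icc`, `pressureTT'_le_hotCeiling_sub_mul_of_floor`;
`tiGroundEnergyDensityAt_field_le_energyDensityTT'`, `energyDensityTT'_sub_le_tiGroundEnergyDensityAt_field`, `varPressureAt_gcInteractionTT'_field_eq_pressureTT'Zeeman`,
`pressureTT'_le_pressureTT'Zeeman`, `pressureTT'Zeeman_le_pressureTT'_add`; `meanEnergy_pencil`, `meanEnergy_numberInteraction`, `meanEnergy_gcInteractionTT'_eq`.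
`lean search 'chemPot.*coexist|Minimiser.*jump|density jump'` (2026-08-28): only the coexistence-interval files (no exclusion reading).

## References
* R. B. Israel, *Convexity in the Theory of Lattice Gases* (1979), Thm. I.2.4. [cite: Israel1979, Thm. I.2.4]
* D. Ruelle, *Statistical Mechanics: Rigorous Results* (1969), §3.4. [cite: Ruelle1969, §3.4] · V. J. Emery, S. A. Kivelson, H. Q. Lin, PRL 64 (1990) 475. [cite: EmeryKivelsonLin1990, pp. 475–476]
* E. H. Lieb, PRL 62 (1989) 1201, proof of Thm. 1. [cite: LiebPRL1989, proof of Theorem 1] · D. Poulin, M. B. Hastings, PRL 106 (2011) 080403. [cite: PoulinHastings2011, eqs. (3)–(8)]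
-/

noncomputable section

open scoped ComplexOrder BigOperators

namespace Literature.MathematicalPhysics.QuantumLattice

open Matrix HubbardWave0 Literature.Probability.LatticeModels ThermodynamicLimit InfVolFermionState FermionInteraction Set

/-! ## §0 The `μ`-shift dictionary for the tree's grand-canonical `t–t'` interactions -/

namespace InfVolFermionState

/-- `e_{Φ − μn}(σ) = e_Φ(σ) − μρ(σ)` for the `μ`-pencil `hubbardTTPrimeMuInteraction t t' U μ`. [cite: Ruelle1969, §3.4] -/
theorem meanEnergy_hubbardTTPrimeMu_eq_sub (t t' U μ : ℝ) (σ : InfVolFermionState 2) :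
    σ.meanEnergy (hubbardTTPrimeMuInteraction t t' U μ) 1 = σ.meanEnergy (hubbardTTPrimeFermionInteraction t t' U) 1 - μ * σ.density := by
  rw [hubbardTTPrimeMuInteraction, meanEnergy_pencil, meanEnergy_numberInteraction]
  ring

/-- `e_{Φ − μn − h(n↑−n↓)}(σ) = e_{Φ − h(n↑−n↓)}(σ) − μρ(σ)`: the grand-canonical interaction at `(μ, h)` is the `μ`-shift of the FIELD
interaction `gcInteractionTT' t t' U 0 h`. [cite: Ruelle1969, §3.4] -/
theorem meanEnergy_gcInteractionTT'_eq_field_sub (t t' U μ hz : ℝ) (σ : InfVolFermionState 2) :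
    σ.meanEnergy (gcInteractionTT' t t' U μ hz) 1 = σ.meanEnergy (gcInteractionTT' t t' U 0 hz) 1 - μ * σ.density := by
  rw [σ.meanEnergy_gcInteractionTT'_eq, σ.meanEnergy_gcInteractionTT'_eq, meanEnergy_numberInteraction]
  ring

/-- Zero field: `e_{gcInteractionTT' t t' U μ 0}(σ) = e_Φ(σ) − μρ(σ)`. [cite: Ruelle1969, §3.4] -/
theorem meanEnergy_gcInteractionTT'_zero_field_eq_sub (t t' U μ : ℝ) (σ : InfVolFermionState 2) :
    σ.meanEnergy (gcInteractionTT' t t' U μ 0) 1 = σ.meanEnergy (hubbardTTPrimeFermionInteraction t t' U) 1 - μ * σ.density := by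
  rw [σ.meanEnergy_gcInteractionTT'_eq, meanEnergy_numberInteraction]
  ring

/-- Weights: `n₁ ≤ an₁ + bn₂ ≤ n₂`. [folklore] -/
private theorem convexComb_mem {a b n₁ n₂ : ℝ} (ha : 0 ≤ a) (hb : 0 ≤ b) (hab : a + b = 1) (h : n₁ ≤ n₂) :
    n₁ ≤ a * n₁ + b * n₂ ∧ a * n₁ + b * n₂ ≤ n₂ := by
  constructor
  · have e : a * n₁ + b * n₂ - n₁ = b * (n₂ - n₁) := by linear_combination n₁ * hab
    nlinarith [mul_nonneg hb (sub_nonneg.2 h)]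
  · have e : n₂ - (a * n₁ + b * n₂) = a * (n₂ - n₁) := by linear_combination (-n₂) * hab
    nlinarith [mul_nonneg ha (sub_nonneg.2 h)]

/-! ## §1 `T = 0`, zero field: grand-canonical ground states of `H − μN` -/

section GroundZeroField

variable (t t' : ℝ) {U : ℝ} (hU : 0 ≤ U) {Γ Γ₁ Γ₂ : FermionInteraction 2} {R' R₁ R₂ μ μ₁ μ₂ : ℝ} {ω ω₁ ω₂ : InfVolFermionState 2}
include hU

/-- **CERTIFIED CHEMICAL-POTENTIAL GAP of the `t–t'` model at `T = 0`.** `0 < n₁ ≤ n₂ < 2`, weights `a, b ≥ 0`, `a + b = 1`; translation-invariant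
grand-canonical ground states `ω₁` of `H − μ₁N` (any `Γ₁` with `e_{Γ₁} = e_Φ − μ₁ρ`) with `ρ(ω₁) ≤ n₁` and `ω₂` of `H − μ₂N` with `n₂ ≤ ρ(ω₂)`; a CAP
`e(an₁ + bn₂) ≤ c` and FLOORS `f₁ ≤ e(n₁)`, `f₂ ≤ e(n₂)` (`e = energyDensityTT' t t' U`). Then `a·b·(n₂ − n₁)·(μ₂ − μ₁) ≥ af₁ + bf₂ − c`.
[cite: Israel1979, Thm. I.2.4] [cite: EmeryKivelsonLin1990, pp. 475–476] -/
theorem margin_le_mul_sub_chemPot_of_groundStates_ttPrime (hω₁ : ω₁.IsMeanEnergyMinimiser Γ₁ R₁)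
    (hΓ₁ : ∀ σ : InfVolFermionState 2, σ.meanEnergy Γ₁ R₁ = σ.meanEnergy (hubbardTTPrimeFermionInteraction t t' U) 1 - μ₁ * σ.density)
    (hω₂ : ω₂.IsMeanEnergyMinimiser Γ₂ R₂)
    (hΓ₂ : ∀ σ : InfVolFermionState 2, σ.meanEnergy Γ₂ R₂ = σ.meanEnergy (hubbardTTPrimeFermionInteraction t t' U) 1 - μ₂ * σ.density)
    {n₁ n₂ : ℝ} (hn₁0 : 0 < n₁) (hn₂2 : n₂ < 2) (hn₁ : ω₁.density ≤ n₁) (hn : n₁ ≤ n₂) (hn₂ : n₂ ≤ ω₂.density)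
    {a b : ℝ} (ha : 0 ≤ a) (hb : 0 ≤ b) (hab : a + b = 1) {c f₁ f₂ : ℝ}
    (hcap : energyDensityTT' t t' U (a * n₁ + b * n₂) ≤ c)
    (hf₁ : f₁ ≤ energyDensityTT' t t' U n₁) (hf₂ : f₂ ≤ energyDensityTT' t t' U n₂) :
    a * f₁ + b * f₂ - c ≤ a * b * (n₂ - n₁) * (μ₂ - μ₁) := by
  obtain ⟨hm1, hm2⟩ := convexComb_mem ha hb hab hn
  rw [← tiGroundEnergyDensityAt_hubbardTTPrime_eq_energyDensityTT' t t' hU (hn₁0.trans_le hm1) (hm2.trans_lt hn₂2)] at hcap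
  rw [← tiGroundEnergyDensityAt_hubbardTTPrime_eq_energyDensityTT' t t' hU hn₁0 (hn.trans_lt hn₂2)] at hf₁
  rw [← tiGroundEnergyDensityAt_hubbardTTPrime_eq_energyDensityTT' t t' hU (hn₁0.trans_le hn) hn₂2] at hf₂
  exact margin_le_mul_sub_chemPot_of_isMeanEnergyMinimiser _ 1 hω₁ hΓ₁ hω₂ hΓ₂ hn₁ hn hn₂ ha hb hab hcap hf₁ hf₂

/-- **NO JUMP OF `n(μ)` ACROSS `[n₁, n₂]` (`t–t'` model, `T = 0`).** With a POSITIVE margin `c < af₁ + bf₂`: if a translation-invariant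
grand-canonical ground state of `H − μN` has density `≤ n₁`, no translation-invariant grand-canonical ground state of the same `H − μN` has
density `≥ n₂`. [cite: Israel1979, Thm. I.2.4] [cite: EmeryKivelsonLin1990, pp. 475–476] -/
theorem IsMeanEnergyMinimiser.not_isMeanEnergyMinimiser_of_le_of_le_ttPrime (hω₁ : ω₁.IsMeanEnergyMinimiser Γ R')
    (hΓ : ∀ σ : InfVolFermionState 2, σ.meanEnergy Γ R' = σ.meanEnergy (hubbardTTPrimeFermionInteraction t t' U) 1 - μ * σ.density)
    {n₁ n₂ : ℝ} (hn₁0 : 0 < n₁) (hn₂2 : n₂ < 2) (hn₁ : ω₁.density ≤ n₁) (hn : n₁ ≤ n₂) (hn₂ : n₂ ≤ ω₂.density)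
    {a b : ℝ} (ha : 0 ≤ a) (hb : 0 ≤ b) (hab : a + b = 1) {c f₁ f₂ : ℝ}
    (hcap : energyDensityTT' t t' U (a * n₁ + b * n₂) ≤ c)
    (hf₁ : f₁ ≤ energyDensityTT' t t' U n₁) (hf₂ : f₂ ≤ energyDensityTT' t t' U n₂) (hc : c < a * f₁ + b * f₂) :
    ¬ ω₂.IsMeanEnergyMinimiser Γ R' := by
  intro hω₂
  have h := margin_le_mul_sub_chemPot_of_groundStates_ttPrime t t' hU hω₁ hΓ hω₂ hΓ hn₁0 hn₂2 hn₁ hn hn₂ ha hb hab hcap hf₁ hf₂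
  rw [sub_self, mul_zero] at h
  linarith

/-- **The chemical potential of a LOW-density grand-canonical ground state is capped**: `ρ(ω) ≤ n₁` at `μ` ⇒ `μ·b(n₂ − n₁) ≤ c − f₁`
(cap at `an₁ + bn₂`, floor at `n₁`). [cite: Ruelle1969, §3.4] -/
theorem IsMeanEnergyMinimiser.chemPot_mul_le_of_density_le_ttPrime (hω : ω.IsMeanEnergyMinimiser Γ R')
    (hΓ : ∀ σ : InfVolFermionState 2, σ.meanEnergy Γ R' = σ.meanEnergy (hubbardTTPrimeFermionInteraction t t' U) 1 - μ * σ.density)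
    {n₁ n₂ : ℝ} (hn₁0 : 0 < n₁) (hn₂2 : n₂ < 2) (hn₁ : ω.density ≤ n₁) (hn : n₁ ≤ n₂)
    {a b : ℝ} (ha : 0 ≤ a) (hb : 0 ≤ b) (hab : a + b = 1) {c f₁ : ℝ}
    (hcap : energyDensityTT' t t' U (a * n₁ + b * n₂) ≤ c) (hf₁ : f₁ ≤ energyDensityTT' t t' U n₁) :
    μ * (b * (n₂ - n₁)) ≤ c - f₁ := by
  obtain ⟨hm1, hm2⟩ := convexComb_mem ha hb hab hn
  have hm0 : 0 < a * n₁ + b * n₂ := hn₁0.trans_le hm1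
  have hm2' : a * n₁ + b * n₂ < 2 := hm2.trans_lt hn₂2
  obtain ⟨σ, hσ, hσρ⟩ := exists_isTranslationInvariant_density_eq hm0 hm2'
  have k := hω.mul_sub_le_sub_of_density_le (hubbardTTPrimeFermionInteraction t t' U) 1 hΓ hσ hn₁ hm1 hσρ.ge
  rw [tiGroundEnergyDensityAt_hubbardTTPrime_eq_energyDensityTT' t t' hU hm0 hm2',
    tiGroundEnergyDensityAt_hubbardTTPrime_eq_energyDensityTT' t t' hU hn₁0 (hn.trans_lt hn₂2),
    show a * n₁ + b * n₂ - n₁ = b * (n₂ - n₁) by linear_combination n₁ * hab] at k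
  linarith

/-- **The chemical potential of a HIGH-density grand-canonical ground state is floored**: `n₂ ≤ ρ(ω)` at `μ` ⇒ `f₂ − c ≤ μ·a(n₂ − n₁)`
(cap at `an₁ + bn₂`, floor at `n₂`). [cite: Ruelle1969, §3.4] -/
theorem IsMeanEnergyMinimiser.sub_le_chemPot_mul_of_le_density_ttPrime (hω : ω.IsMeanEnergyMinimiser Γ R')
    (hΓ : ∀ σ : InfVolFermionState 2, σ.meanEnergy Γ R' = σ.meanEnergy (hubbardTTPrimeFermionInteraction t t' U) 1 - μ * σ.density)
    {n₁ n₂ : ℝ} (hn₁0 : 0 < n₁) (hn₂2 : n₂ < 2) (hn : n₁ ≤ n₂) (hn₂ : n₂ ≤ ω.density)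
    {a b : ℝ} (ha : 0 ≤ a) (hb : 0 ≤ b) (hab : a + b = 1) {c f₂ : ℝ}
    (hcap : energyDensityTT' t t' U (a * n₁ + b * n₂) ≤ c) (hf₂ : f₂ ≤ energyDensityTT' t t' U n₂) :
    f₂ - c ≤ μ * (a * (n₂ - n₁)) := by
  obtain ⟨hm1, hm2⟩ := convexComb_mem ha hb hab hn
  have hm0 : 0 < a * n₁ + b * n₂ := hn₁0.trans_le hm1
  have hm2' : a * n₁ + b * n₂ < 2 := hm2.trans_lt hn₂2
  obtain ⟨σ, hσ, hσρ⟩ := exists_isTranslationInvariant_density_eq hm0 hm2'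
  have k := hω.sub_le_mul_sub_of_le_density (hubbardTTPrimeFermionInteraction t t' U) 1 hΓ hσ hσρ.le hm2 hn₂
  rw [tiGroundEnergyDensityAt_hubbardTTPrime_eq_energyDensityTT' t t' hU hm0 hm2',
    tiGroundEnergyDensityAt_hubbardTTPrime_eq_energyDensityTT' t t' hU (hn₁0.trans_le hn) hn₂2,
    show n₂ - (a * n₁ + b * n₂) = a * (n₂ - n₁) by linear_combination (-n₂) * hab] at k
  linarith

end GroundZeroField

/-! ## §2 `T > 0`, zero field: grand-canonical equilibrium states of `H − μN`, hot-anchored windows -/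

section ThermalZeroField

variable (t t' : ℝ) {U : ℝ} (hU : 0 ≤ U) {β : ℝ} (hβ : 0 < β) {Γ Γ₁ Γ₂ : FermionInteraction 2} {R' R₁ R₂ μ μ₁ μ₂ : ℝ}
  {ω ω₁ ω₂ : InfVolFermionState 2}
include hU hβ

/-- **CERTIFIED CHEMICAL-POTENTIAL GAP at `T > 0` from HOT ANCHORS (`t–t'` model).** `0 < n₁ ≤ n₂ < 2`; variational equilibria `ω₁` of
`H − μ₁N` at `β` with `ρ(ω₁) ≤ n₁` and `ω₂` of `H − μ₂N` at `β` with `n₂ ≤ ρ(ω₂)`; a ground-state energy CAP `e(an₁ + bn₂) ≤ c`, FLOORS `f_i ≤ e(n_i)`,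
pressure ceilings `p(β_{h,i}; n_i) ≤ π_i` at hotter `0 ≤ β_{h,i} ≤ β`. Then
`a·b·(n₂ − n₁)·β(μ₂ − μ₁) ≥ β(af₁ + bf₂ − c) − (aπ₁ + bπ₂ + β_{h,1}af₁ + β_{h,2}bf₂)` (pressure floor `−βc` at the mean density, hot-anchored caps
`π_i − (β − β_{h,i})f_i` at the outer ones). [cite: Israel1979, Thm. I.2.4] [cite: PoulinHastings2011, eqs. (3)–(8)] -/
theorem margin_le_mul_sub_chemPot_of_equilibria_hotAnchors_ttPrime (hω₁ : ω₁.IsVarEquilibrium β Γ₁ R₁)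
    (hΓ₁ : ∀ σ : InfVolFermionState 2, σ.meanEnergy Γ₁ R₁ = σ.meanEnergy (hubbardTTPrimeFermionInteraction t t' U) 1 - μ₁ * σ.density)
    (hω₂ : ω₂.IsVarEquilibrium β Γ₂ R₂)
    (hΓ₂ : ∀ σ : InfVolFermionState 2, σ.meanEnergy Γ₂ R₂ = σ.meanEnergy (hubbardTTPrimeFermionInteraction t t' U) 1 - μ₂ * σ.density)
    {n₁ n₂ : ℝ} (hn₁0 : 0 < n₁) (hn₂2 : n₂ < 2) (hn₁ : ω₁.density ≤ n₁) (hn : n₁ ≤ n₂) (hn₂ : n₂ ≤ ω₂.density)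
    {a b : ℝ} (ha : 0 ≤ a) (hb : 0 ≤ b) (hab : a + b = 1) {c f₁ f₂ : ℝ}
    (hcap : energyDensityTT' t t' U (a * n₁ + b * n₂) ≤ c)
    (hf₁ : f₁ ≤ energyDensityTT' t t' U n₁) (hf₂ : f₂ ≤ energyDensityTT' t t' U n₂)
    {βh₁ βh₂ π₁ π₂ : ℝ} (hβh₁ : 0 ≤ βh₁) (hβh₂ : 0 ≤ βh₂) (hle₁ : βh₁ ≤ β) (hle₂ : βh₂ ≤ β)
    (hπ₁ : pressureTT' βh₁ t t' U n₁ ≤ π₁) (hπ₂ : pressureTT' βh₂ t t' U n₂ ≤ π₂) :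
    β * (a * f₁ + b * f₂ - c) - (a * π₁ + b * π₂ + βh₁ * (a * f₁) + βh₂ * (b * f₂)) ≤
      a * b * (n₂ - n₁) * (β * (μ₂ - μ₁)) := by
  obtain ⟨hm1, hm2⟩ := convexComb_mem ha hb hab hn
  have hm0 : 0 < a * n₁ + b * n₂ := hn₁0.trans_le hm1; have hm2' : a * n₁ + b * n₂ < 2 := hm2.trans_lt hn₂2
  have hn₁2 : n₁ < 2 := hn.trans_lt hn₂2; have hn₂0 : 0 < n₂ := hn₁0.trans_le hn
  have hW := (pressureTT'_mem_Icc hβ.le t t' hU hm0.le hm2').1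
  have hQ₁ := pressureTT'_le_hotCeiling_sub_mul_of_floor t t' hU hn₁0.le hn₁2 hβh₁ hle₁ hπ₁ hf₁
  have hQ₂ := pressureTT'_le_hotCeiling_sub_mul_of_floor t t' hU hn₂0.le hn₂2 hβh₂ hle₂ hπ₂ hf₂
  rw [← varPressureAt_hubbardTTPrime_eq hβ t t' hU hm0 hm2'] at hW
  rw [← varPressureAt_hubbardTTPrime_eq hβ t t' hU hn₁0 hn₁2] at hQ₁
  rw [← varPressureAt_hubbardTTPrime_eq hβ t t' hU hn₂0 hn₂2] at hQ₂
  have h := pressureMargin_le_mul_sub_chemPot_of_isVarEquilibrium (by norm_num : 0 < 2) β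
    (hubbardTTPrimeFermionInteraction t t' U) 1 hω₁ hΓ₁ hω₂ hΓ₂ hn₁ hn hn₂ ha hb hab hW hQ₁ hQ₂
  have k3 := mul_le_mul_of_nonneg_left hcap hβ.le
  have e : -(β * energyDensityTT' t t' U (a * n₁ + b * n₂)) - a * (π₁ - (β - βh₁) * f₁) - b * (π₂ - (β - βh₂) * f₂) =
      β * (a * f₁ + b * f₂) - β * energyDensityTT' t t' U (a * n₁ + b * n₂) -
        (a * π₁ + b * π₂ + βh₁ * (a * f₁) + βh₂ * (b * f₂)) := by ring
  rw [e] at h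
  nlinarith [h, k3]

/-- **NO JUMP OF `n(β, μ)` ACROSS `[n₁, n₂]` (`t–t'` model, `T > 0`, hot anchors).** If
`aπ₁ + bπ₂ + β_{h,1}af₁ + β_{h,2}bf₂ < β·(af₁ + bf₂ − c)`, then at ONE `(β, μ)` the variational equilibria of `H − μN` never contain both a state
of density `≤ n₁` and one of density `≥ n₂`. [cite: Israel1979, Thm. I.2.4] [cite: PoulinHastings2011, eqs. (3)–(8)] -/
theorem IsVarEquilibrium.not_isVarEquilibrium_of_le_of_le_hotAnchors_ttPrime (hω₁ : ω₁.IsVarEquilibrium β Γ R')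
    (hΓ : ∀ σ : InfVolFermionState 2, σ.meanEnergy Γ R' = σ.meanEnergy (hubbardTTPrimeFermionInteraction t t' U) 1 - μ * σ.density)
    {n₁ n₂ : ℝ} (hn₁0 : 0 < n₁) (hn₂2 : n₂ < 2) (hn₁ : ω₁.density ≤ n₁) (hn : n₁ ≤ n₂) (hn₂ : n₂ ≤ ω₂.density)
    {a b : ℝ} (ha : 0 ≤ a) (hb : 0 ≤ b) (hab : a + b = 1) {c f₁ f₂ : ℝ}
    (hcap : energyDensityTT' t t' U (a * n₁ + b * n₂) ≤ c)
    (hf₁ : f₁ ≤ energyDensityTT' t t' U n₁) (hf₂ : f₂ ≤ energyDensityTT' t t' U n₂)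
    {βh₁ βh₂ π₁ π₂ : ℝ} (hβh₁ : 0 ≤ βh₁) (hβh₂ : 0 ≤ βh₂) (hle₁ : βh₁ ≤ β) (hle₂ : βh₂ ≤ β)
    (hπ₁ : pressureTT' βh₁ t t' U n₁ ≤ π₁) (hπ₂ : pressureTT' βh₂ t t' U n₂ ≤ π₂)
    (hM : a * π₁ + b * π₂ + βh₁ * (a * f₁) + βh₂ * (b * f₂) < β * (a * f₁ + b * f₂ - c)) :
    ¬ ω₂.IsVarEquilibrium β Γ R' := by
  intro hω₂
  have h := margin_le_mul_sub_chemPot_of_equilibria_hotAnchors_ttPrime t t' hU hβ hω₁ hΓ hω₂ hΓ hn₁0 hn₂2 hn₁ hn hn₂ ha hb hab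
    hcap hf₁ hf₂ hβh₁ hβh₂ hle₁ hle₂ hπ₁ hπ₂
  rw [sub_self, mul_zero, mul_zero] at h
  linarith

/-- **Threshold form** («for every `β ≥ β₀`»): with `M := af₁ + bf₂ − c ≥ 0` and `aπ₁ + bπ₂ + β_{h,1}af₁ + β_{h,2}bf₂ < β₀·M`,
`β_{h,i} ≤ β₀ ≤ β`: no equilibrium pair `(≤ n₁, ≥ n₂)` at `(β, μ)`. [cite: Israel1979, Thm. I.2.4] [cite: PoulinHastings2011, eqs. (3)–(8)] -/
theorem IsVarEquilibrium.not_isVarEquilibrium_of_le_of_le_hotAnchors_threshold_ttPrime (hω₁ : ω₁.IsVarEquilibrium β Γ R')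
    (hΓ : ∀ σ : InfVolFermionState 2, σ.meanEnergy Γ R' = σ.meanEnergy (hubbardTTPrimeFermionInteraction t t' U) 1 - μ * σ.density)
    {n₁ n₂ : ℝ} (hn₁0 : 0 < n₁) (hn₂2 : n₂ < 2) (hn₁ : ω₁.density ≤ n₁) (hn : n₁ ≤ n₂) (hn₂ : n₂ ≤ ω₂.density)
    {a b : ℝ} (ha : 0 ≤ a) (hb : 0 ≤ b) (hab : a + b = 1) {c f₁ f₂ : ℝ}
    (hcap : energyDensityTT' t t' U (a * n₁ + b * n₂) ≤ c)
    (hf₁ : f₁ ≤ energyDensityTT' t t' U n₁) (hf₂ : f₂ ≤ energyDensityTT' t t' U n₂)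
    {βh₁ βh₂ π₁ π₂ β₀ : ℝ} (hβh₁ : 0 ≤ βh₁) (hβh₂ : 0 ≤ βh₂) (h0₁ : βh₁ ≤ β₀) (h0₂ : βh₂ ≤ β₀) (hβ₀ : β₀ ≤ β)
    (hπ₁ : pressureTT' βh₁ t t' U n₁ ≤ π₁) (hπ₂ : pressureTT' βh₂ t t' U n₂ ≤ π₂)
    (hMnn : 0 ≤ a * f₁ + b * f₂ - c) (hM₀ : a * π₁ + b * π₂ + βh₁ * (a * f₁) + βh₂ * (b * f₂) < β₀ * (a * f₁ + b * f₂ - c)) :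
    ¬ ω₂.IsVarEquilibrium β Γ R' := by
  have k := mul_le_mul_of_nonneg_right hβ₀ hMnn
  exact hω₁.not_isVarEquilibrium_of_le_of_le_hotAnchors_ttPrime t t' hU hβ hΓ hn₁0 hn₂2 hn₁ hn hn₂ ha hb hab hcap hf₁ hf₂ hβh₁ hβh₂
    (h0₁.trans hβ₀) (h0₂.trans hβ₀) hπ₁ hπ₂ (hM₀.trans_le k)

/-- **Gap, threshold form** («for every `β ≥ β₀` the distance is `≥ g/(ab(n₂−n₁))`»): with `g ≤ M`,
`aπ₁ + bπ₂ + β_{h,1}af₁ + β_{h,2}bf₂ ≤ β₀·(M − g)` and `β_{h,i} ≤ β₀ ≤ β`: `β·g ≤ a·b·(n₂ − n₁)·β(μ₂ − μ₁)` (`βM − N ≥ βM − β₀(M − g) ≥ βg`).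
[cite: Israel1979, Thm. I.2.4] [cite: PoulinHastings2011, eqs. (3)–(8)] -/
theorem mul_gap_le_mul_sub_chemPot_of_equilibria_hotAnchors_threshold_ttPrime (hω₁ : ω₁.IsVarEquilibrium β Γ₁ R₁)
    (hΓ₁ : ∀ σ : InfVolFermionState 2, σ.meanEnergy Γ₁ R₁ = σ.meanEnergy (hubbardTTPrimeFermionInteraction t t' U) 1 - μ₁ * σ.density)
    (hω₂ : ω₂.IsVarEquilibrium β Γ₂ R₂)
    (hΓ₂ : ∀ σ : InfVolFermionState 2, σ.meanEnergy Γ₂ R₂ = σ.meanEnergy (hubbardTTPrimeFermionInteraction t t' U) 1 - μ₂ * σ.density)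
    {n₁ n₂ : ℝ} (hn₁0 : 0 < n₁) (hn₂2 : n₂ < 2) (hn₁ : ω₁.density ≤ n₁) (hn : n₁ ≤ n₂) (hn₂ : n₂ ≤ ω₂.density)
    {a b : ℝ} (ha : 0 ≤ a) (hb : 0 ≤ b) (hab : a + b = 1) {c f₁ f₂ : ℝ}
    (hcap : energyDensityTT' t t' U (a * n₁ + b * n₂) ≤ c)
    (hf₁ : f₁ ≤ energyDensityTT' t t' U n₁) (hf₂ : f₂ ≤ energyDensityTT' t t' U n₂)
    {βh₁ βh₂ π₁ π₂ β₀ g : ℝ} (hβh₁ : 0 ≤ βh₁) (hβh₂ : 0 ≤ βh₂) (h0₁ : βh₁ ≤ β₀) (h0₂ : βh₂ ≤ β₀) (hβ₀ : β₀ ≤ β)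
    (hπ₁ : pressureTT' βh₁ t t' U n₁ ≤ π₁) (hπ₂ : pressureTT' βh₂ t t' U n₂ ≤ π₂) (hgM : g ≤ a * f₁ + b * f₂ - c)
    (hN : a * π₁ + b * π₂ + βh₁ * (a * f₁) + βh₂ * (b * f₂) ≤ β₀ * (a * f₁ + b * f₂ - c - g)) :
    β * g ≤ a * b * (n₂ - n₁) * (β * (μ₂ - μ₁)) := by
  have h := margin_le_mul_sub_chemPot_of_equilibria_hotAnchors_ttPrime t t' hU hβ hω₁ hΓ₁ hω₂ hΓ₂ hn₁0 hn₂2 hn₁ hn hn₂ ha hb hab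
    hcap hf₁ hf₂ hβh₁ hβh₂ (h0₁.trans hβ₀) (h0₂.trans hβ₀) hπ₁ hπ₂
  have k : β₀ * (a * f₁ + b * f₂ - c - g) ≤ β * (a * f₁ + b * f₂ - c - g) :=
    mul_le_mul_of_nonneg_right hβ₀ (by linarith)
  nlinarith [h, k]

end ThermalZeroField

/-! ## §3 IN A ZEEMAN FIELD `h`: grand-canonical states of `H − μN − h(N↑ − N↓)` = `gcInteractionTT' t t' U μ h` -/

section Field

variable (t t' : ℝ) {U : ℝ} (hU : 0 ≤ U) {μ μ₁ μ₂ : ℝ} (hz : ℝ) {ω ω₁ ω₂ : InfVolFermionState 2}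
include hU

/-- **`T = 0` gap IN A FIELD.** Grand-canonical ground states `ω₁` of `gcInteractionTT' t t' U μ₁ h` with `ρ(ω₁) ≤ n₁` and `ω₂` of
`gcInteractionTT' t t' U μ₂ h` with `n₂ ≤ ρ(ω₂)` (`0 < n₁ ≤ n₂ < 2`); ZERO-FIELD cap `e(an₁ + bn₂) ≤ c` and floors `f_i ≤ e(n_i)`. Then
`a·b·(n₂ − n₁)·(μ₂ − μ₁) ≥ af₁ + bf₂ − c − |h|·(a·min(n₁,2−n₁) + b·min(n₂,2−n₂))` (field windows of `HubbardTTPrimeGroundEnergyZeeman`).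
[cite: Israel1979, Thm. I.2.4] [cite: LiebPRL1989, proof of Theorem 1] -/
theorem margin_le_mul_sub_chemPot_of_groundStates_field_ttPrime (hω₁ : ω₁.IsMeanEnergyMinimiser (gcInteractionTT' t t' U μ₁ hz) 1)
    (hω₂ : ω₂.IsMeanEnergyMinimiser (gcInteractionTT' t t' U μ₂ hz) 1)
    {n₁ n₂ : ℝ} (hn₁0 : 0 < n₁) (hn₂2 : n₂ < 2) (hn₁ : ω₁.density ≤ n₁) (hn : n₁ ≤ n₂) (hn₂ : n₂ ≤ ω₂.density)
    {a b : ℝ} (ha : 0 ≤ a) (hb : 0 ≤ b) (hab : a + b = 1) {c f₁ f₂ : ℝ}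
    (hcap : energyDensityTT' t t' U (a * n₁ + b * n₂) ≤ c)
    (hf₁ : f₁ ≤ energyDensityTT' t t' U n₁) (hf₂ : f₂ ≤ energyDensityTT' t t' U n₂) :
    a * f₁ + b * f₂ - c - |hz| * (a * min n₁ (2 - n₁) + b * min n₂ (2 - n₂)) ≤ a * b * (n₂ - n₁) * (μ₂ - μ₁) := by
  obtain ⟨hm1, hm2⟩ := convexComb_mem ha hb hab hn
  have hm0 : 0 < a * n₁ + b * n₂ := hn₁0.trans_le hm1; have hm2' : a * n₁ + b * n₂ < 2 := hm2.trans_lt hn₂2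
  have hn₁2 : n₁ < 2 := hn.trans_lt hn₂2; have hn₂0 : 0 < n₂ := hn₁0.trans_le hn
  have hcap' := (tiGroundEnergyDensityAt_field_le_energyDensityTT' t t' hU hm0 hm2' hz).trans hcap
  have hf₁' := energyDensityTT'_sub_le_tiGroundEnergyDensityAt_field t t' hU hn₁0 hn₁2 hz
  have hf₂' := energyDensityTT'_sub_le_tiGroundEnergyDensityAt_field t t' hU hn₂0 hn₂2 hz
  have h := margin_le_mul_sub_chemPot_of_isMeanEnergyMinimiser (gcInteractionTT' t t' U 0 hz) 1 hω₁
    (meanEnergy_gcInteractionTT'_eq_field_sub t t' U μ₁ hz) hω₂ (meanEnergy_gcInteractionTT'_eq_field_sub t t' U μ₂ hz)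
    hn₁ hn hn₂ ha hb hab hcap' (f₁ := f₁ - |hz| * min n₁ (2 - n₁)) (f₂ := f₂ - |hz| * min n₂ (2 - n₂))
    (by linarith) (by linarith)
  linarith [h]

/-- **NO JUMP OF `n(μ, h)` ACROSS `[n₁, n₂]` AT `T = 0`, every `|h| ≤ h₀`** with `c + h₀·(a·min(n₁,2−n₁) + b·min(n₂,2−n₂)) < af₁ + bf₂`:
at one `(μ, h)` the grand-canonical ground states never contain both a state of density `≤ n₁` and one of density `≥ n₂`.
[cite: Israel1979, Thm. I.2.4] [cite: LiebPRL1989, proof of Theorem 1] -/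
theorem IsMeanEnergyMinimiser.not_isMeanEnergyMinimiser_of_le_of_le_field_ttPrime
    (hω₁ : ω₁.IsMeanEnergyMinimiser (gcInteractionTT' t t' U μ hz) 1)
    {n₁ n₂ : ℝ} (hn₁0 : 0 < n₁) (hn₂2 : n₂ < 2) (hn₁ : ω₁.density ≤ n₁) (hn : n₁ ≤ n₂) (hn₂ : n₂ ≤ ω₂.density)
    {a b : ℝ} (ha : 0 ≤ a) (hb : 0 ≤ b) (hab : a + b = 1) {c f₁ f₂ h₀ : ℝ} (hh : |hz| ≤ h₀)
    (hcap : energyDensityTT' t t' U (a * n₁ + b * n₂) ≤ c)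
    (hf₁ : f₁ ≤ energyDensityTT' t t' U n₁) (hf₂ : f₂ ≤ energyDensityTT' t t' U n₂)
    (hM : c + h₀ * (a * min n₁ (2 - n₁) + b * min n₂ (2 - n₂)) < a * f₁ + b * f₂) :
    ¬ ω₂.IsMeanEnergyMinimiser (gcInteractionTT' t t' U μ hz) 1 := by
  intro hω₂
  have h := margin_le_mul_sub_chemPot_of_groundStates_field_ttPrime t t' hU hz hω₁ hω₂ hn₁0 hn₂2 hn₁ hn hn₂ ha hb hab hcap hf₁ hf₂
  rw [sub_self, mul_zero] at h
  have hmbar : 0 ≤ a * min n₁ (2 - n₁) + b * min n₂ (2 - n₂) :=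
    add_nonneg (mul_nonneg ha (le_min hn₁0.le (by linarith))) (mul_nonneg hb (le_min (by linarith) (by linarith)))
  have k := mul_le_mul_of_nonneg_right hh hmbar
  linarith

variable {β : ℝ} (hβ : 0 < β)
include hβ

/-- **`T > 0` gap IN A FIELD from zero-field hot anchors.** Variational equilibria `ω₁` of `gcInteractionTT' t t' U μ₁ h` at `β` with
`ρ(ω₁) ≤ n₁` and `ω₂` of `gcInteractionTT' t t' U μ₂ h` with `n₂ ≤ ρ(ω₂)`; zero-field cap, floors and pressure ceilings as in §2. Then
`a·b·(n₂ − n₁)·β(μ₂ − μ₁) ≥ β(M − |h|·m̄) − N`, `M = af₁ + bf₂ − c`, `m̄ = a·min(n₁,2−n₁) + b·min(n₂,2−n₂)`,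
`N = aπ₁ + bπ₂ + β_{h,1}af₁ + β_{h,2}bf₂`. [cite: Israel1979, Thm. I.2.4] [cite: LiebPRL1989, proof of Theorem 1] -/
theorem margin_le_mul_sub_chemPot_of_equilibria_hotAnchors_field_ttPrime
    (hω₁ : ω₁.IsVarEquilibrium β (gcInteractionTT' t t' U μ₁ hz) 1) (hω₂ : ω₂.IsVarEquilibrium β (gcInteractionTT' t t' U μ₂ hz) 1)
    {n₁ n₂ : ℝ} (hn₁0 : 0 < n₁) (hn₂2 : n₂ < 2) (hn₁ : ω₁.density ≤ n₁) (hn : n₁ ≤ n₂) (hn₂ : n₂ ≤ ω₂.density)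
    {a b : ℝ} (ha : 0 ≤ a) (hb : 0 ≤ b) (hab : a + b = 1) {c f₁ f₂ : ℝ}
    (hcap : energyDensityTT' t t' U (a * n₁ + b * n₂) ≤ c)
    (hf₁ : f₁ ≤ energyDensityTT' t t' U n₁) (hf₂ : f₂ ≤ energyDensityTT' t t' U n₂)
    {βh₁ βh₂ π₁ π₂ : ℝ} (hβh₁ : 0 ≤ βh₁) (hβh₂ : 0 ≤ βh₂) (hle₁ : βh₁ ≤ β) (hle₂ : βh₂ ≤ β)
    (hπ₁ : pressureTT' βh₁ t t' U n₁ ≤ π₁) (hπ₂ : pressureTT' βh₂ t t' U n₂ ≤ π₂) :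
    β * (a * f₁ + b * f₂ - c - |hz| * (a * min n₁ (2 - n₁) + b * min n₂ (2 - n₂))) -
        (a * π₁ + b * π₂ + βh₁ * (a * f₁) + βh₂ * (b * f₂)) ≤ a * b * (n₂ - n₁) * (β * (μ₂ - μ₁)) := by
  obtain ⟨hm1, hm2⟩ := convexComb_mem ha hb hab hn
  have hm0 : 0 < a * n₁ + b * n₂ := hn₁0.trans_le hm1; have hm2' : a * n₁ + b * n₂ < 2 := hm2.trans_lt hn₂2
  have hn₁2 : n₁ < 2 := hn.trans_lt hn₂2; have hn₂0 : 0 < n₂ := hn₁0.trans_le hn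
  have hW0 := (pressureTT'_mem_Icc hβ.le t t' hU hm0.le hm2').1
  have hQ₁0 := pressureTT'_le_hotCeiling_sub_mul_of_floor t t' hU hn₁0.le hn₁2 hβh₁ hle₁ hπ₁ hf₁
  have hQ₂0 := pressureTT'_le_hotCeiling_sub_mul_of_floor t t' hU hn₂0.le hn₂2 hβh₂ hle₂ hπ₂ hf₂
  have hW := hW0.trans (pressureTT'_le_pressureTT'Zeeman hβ.le t t' hU hm0.le hm2' hz)
  have hQ₁ := (pressureTT'Zeeman_le_pressureTT'_add hβ.le t t' hU hn₁0.le hn₁2 hz).trans (add_le_add hQ₁0 le_rfl)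
  have hQ₂ := (pressureTT'Zeeman_le_pressureTT'_add hβ.le t t' hU hn₂0.le hn₂2 hz).trans (add_le_add hQ₂0 le_rfl)
  rw [← varPressureAt_gcInteractionTT'_field_eq_pressureTT'Zeeman hβ t t' hU hm0 hm2' hz] at hW
  rw [← varPressureAt_gcInteractionTT'_field_eq_pressureTT'Zeeman hβ t t' hU hn₁0 hn₁2 hz] at hQ₁
  rw [← varPressureAt_gcInteractionTT'_field_eq_pressureTT'Zeeman hβ t t' hU hn₂0 hn₂2 hz] at hQ₂
  have h := pressureMargin_le_mul_sub_chemPot_of_isVarEquilibrium (by norm_num : 0 < 2) β (gcInteractionTT' t t' U 0 hz) 1 hω₁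
    (meanEnergy_gcInteractionTT'_eq_field_sub t t' U μ₁ hz) hω₂ (meanEnergy_gcInteractionTT'_eq_field_sub t t' U μ₂ hz)
    hn₁ hn hn₂ ha hb hab hW hQ₁ hQ₂
  have k3 := mul_le_mul_of_nonneg_left hcap hβ.le
  have e : -(β * energyDensityTT' t t' U (a * n₁ + b * n₂)) -
      a * (π₁ - (β - βh₁) * f₁ + β * |hz| * min n₁ (2 - n₁)) - b * (π₂ - (β - βh₂) * f₂ + β * |hz| * min n₂ (2 - n₂)) =
      β * (a * f₁ + b * f₂ - |hz| * (a * min n₁ (2 - n₁) + b * min n₂ (2 - n₂))) - β * energyDensityTT' t t' U (a * n₁ + b * n₂) -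
        (a * π₁ + b * π₂ + βh₁ * (a * f₁) + βh₂ * (b * f₂)) := by ring
  rw [e] at h
  nlinarith [h, k3]

/-- **NO JUMP OF `n(β; μ, h)` ACROSS `[n₁, n₂]`, every `β ≥ β₀` and every `|h| ≤ h₀`** (threshold form, zero-field hot anchors): with
`M := af₁ + bf₂ − c`, `m̄ := a·min(n₁,2−n₁) + b·min(n₂,2−n₂)`, `h₀m̄ ≤ M`, `aπ₁ + bπ₂ + β_{h,1}af₁ + β_{h,2}bf₂ < β₀·(M − h₀m̄)`, `β_{h,i} ≤ β₀ ≤ β`: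
at one `(β; μ, h)` the variational equilibria of `H − μN − h(N↑−N↓)` never contain both a state of density `≤ n₁` and one of density `≥ n₂`.
[cite: Israel1979, Thm. I.2.4] [cite: LiebPRL1989, proof of Theorem 1] -/
theorem IsVarEquilibrium.not_isVarEquilibrium_of_le_of_le_hotAnchors_field_threshold_ttPrime
    (hω₁ : ω₁.IsVarEquilibrium β (gcInteractionTT' t t' U μ hz) 1)
    {n₁ n₂ : ℝ} (hn₁0 : 0 < n₁) (hn₂2 : n₂ < 2) (hn₁ : ω₁.density ≤ n₁) (hn : n₁ ≤ n₂) (hn₂ : n₂ ≤ ω₂.density)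
    {a b : ℝ} (ha : 0 ≤ a) (hb : 0 ≤ b) (hab : a + b = 1) {c f₁ f₂ : ℝ}
    (hcap : energyDensityTT' t t' U (a * n₁ + b * n₂) ≤ c)
    (hf₁ : f₁ ≤ energyDensityTT' t t' U n₁) (hf₂ : f₂ ≤ energyDensityTT' t t' U n₂)
    {βh₁ βh₂ π₁ π₂ β₀ h₀ : ℝ} (hβh₁ : 0 ≤ βh₁) (hβh₂ : 0 ≤ βh₂) (h0₁ : βh₁ ≤ β₀) (h0₂ : βh₂ ≤ β₀) (hβ₀ : β₀ ≤ β)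
    (hπ₁ : pressureTT' βh₁ t t' U n₁ ≤ π₁) (hπ₂ : pressureTT' βh₂ t t' U n₂ ≤ π₂) (hh : |hz| ≤ h₀)
    (hMh : h₀ * (a * min n₁ (2 - n₁) + b * min n₂ (2 - n₂)) ≤ a * f₁ + b * f₂ - c)
    (hM₀ : a * π₁ + b * π₂ + βh₁ * (a * f₁) + βh₂ * (b * f₂) <
      β₀ * (a * f₁ + b * f₂ - c - h₀ * (a * min n₁ (2 - n₁) + b * min n₂ (2 - n₂)))) :
    ¬ ω₂.IsVarEquilibrium β (gcInteractionTT' t t' U μ hz) 1 := by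
  intro hω₂
  have h := margin_le_mul_sub_chemPot_of_equilibria_hotAnchors_field_ttPrime t t' hU hz hβ hω₁ hω₂ hn₁0 hn₂2 hn₁ hn hn₂ ha hb hab
    hcap hf₁ hf₂ hβh₁ hβh₂ (h0₁.trans hβ₀) (h0₂.trans hβ₀) hπ₁ hπ₂
  rw [sub_self, mul_zero, mul_zero] at h
  have hmbar : 0 ≤ a * min n₁ (2 - n₁) + b * min n₂ (2 - n₂) :=
    add_nonneg (mul_nonneg ha (le_min hn₁0.le (by linarith))) (mul_nonneg hb (le_min (by linarith) (by linarith)))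
  have k1 := mul_le_mul_of_nonneg_right hh hmbar
  have k2 : β₀ * (a * f₁ + b * f₂ - c - h₀ * (a * min n₁ (2 - n₁) + b * min n₂ (2 - n₂))) ≤
      β * (a * f₁ + b * f₂ - c - h₀ * (a * min n₁ (2 - n₁) + b * min n₂ (2 - n₂))) :=
    mul_le_mul_of_nonneg_right hβ₀ (by linarith)
  have k3 := mul_le_mul_of_nonneg_left k1 hβ.le
  nlinarith [h, k1, k2, k3]

end Field

end InfVolFermionState

end Literature.MathematicalPhysics.QuantumLattice

end
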